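import Summits.BirchSwinnertonDyer.BirchSwinnertonDyer.Theorems.ThetaPartnerAtTwoSignedControlAtTwoShaThreeExtension
import Literature.NumberTheory.GaloisRepresentations.ConjugationDescent
import Literature.NumberTheory.GaloisRepresentations.GaloisCohomologyCorestriction
import Literature.NumberTheory.GaloisRepresentations.RestrictionOpenSubgroupIndex
import Literature.NumberTheory.GaloisRepresentations.AbsGaloisRestrictRealPlace
import Literature.NumberTheory.GaloisRepresentations.AbsGaloisInvolutionsRealPlacePerm
import Literature.NumberTheory.GaloisCohomology.ArchimedeanInvariantMap
import HarnessLib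

/-!
# Poitou–Tate in degree `3` at the real places DESCENDS along an odd-degree extension
# (K4 `SignedControlAtTwo` stub 3 `stub_poitouTateThreeRealRat`; Milne I Thm. 4.10 (c), `r = 3`)

Route `ThetaPartnerAtTwo` (TP2; crux shared with `ResidualThetaTransportAtTwo`), crux K4 `SignedControlAtTwo`
(stmt-BirchSwinnertonDyer-20309), line `eulerchar` v12, registered stub
`stub_poitouTateThreeRealRat : poitouTate_three_realPlaces_injective ℚ`.  Seat `prover-bsd-wall-tp2-p3` (lead, gen 5).
Brick B2 of the lead's dévissage (B1 `…ShaThreeExtension` = extension step, B3 `…ShaThreePGroup` = `2`-group step).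

* §1 `map_eq_map_of_inner_three` — **inner automorphisms act trivially on `H³`** (Serre, *Corps locaux* VII §5
  Prop. 3), relative form of the tree's `map_eq_map_of_inner_one/_two` (`ConjugationDescent.lean`): the pull-backs
  along `θ = g⁻¹ ι g` and `ι` with compatible coefficient maps agree on `H³` (explicit `2`-cochain
  `h(σ, τ) = z(g, σ^g, τ^g) - z(σ, g, τ^g) + z(σ, τ, g)`, four instances of the `3`-cocycle identity).
* §2 `pullback_three_eq_zero_of_forall_localization_inl` — for a number field `K`, a class `x ∈ H³(K, M)` vanishing
  at every real place, and a continuous homomorphism `ψ : Γ_L →ₜ* Γ_K` from a Galois group `Γ_L = {1, σ}` whose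
  non-trivial element goes to an INVOLUTION of `Γ_K`, the pull-back of `x` along `ψ` vanishes: `ψ σ` is a complex
  conjugation at some real place `w₀` (Artin–Schreier, tree `exists_isComplexConjugationAt_of_sq_eq_one`), hence
  conjugate to the image of the non-trivial element of `Γ_{K_{w₀}}` (tree `IsComplexConjugationAt.isConj_iff_eq`),
  and §1 plus `loc_{w₀} x = 0` conclude.
* §3 `localization_inl_res_three_eq_zero` — consequently, for a finite extension `F/K` and every real place `w'` of
  `F`, `loc_{w'} (Res_{F/K} x) = 0` (tree `galoisCohomology.res_comp`, `absGaloisRestrict_ne_one_of_isReal`).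
* §4 `eq_zero_of_res_eq_zero_of_psmul_eq_zero` — `Res_{F/K} : Hⁿ(K, M) → Hⁿ(F, M)` is injective on classes
  killed by a power of `p` when `p ∤ [F : K]` (tree `rangeTransport_res` + Serre I §2.4 Prop. 9
  `index_smul_eq_zero_of_Hpullback_eq_zero_int` + Bezout).
* §5 `realThree_injective_of_odd_extension` — **the descent**: if `M` is killed by `2^r`, `[F : K]` is odd and
  real-place injectivity of `H³` holds for `M|_{Γ_F}` over `F`, it holds for `M` over `K`.

HONEST FRAMING: THEOREMS ONLY (no definition, no named fact, no `sorry`); nothing specific to elliptic curves; closes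
no item by itself; BSD is not proved by any of this.

References: [SerreLocalFields1979] VII §5 Prop. 3; [SerreGaloisCohomology1997] I §2.4 Prop. 9, II §6.1;
[MilneADT2006] I Thm. 4.10 (c); [ArtinSchreier1927Kennzeichnung] Satz 4.
-/

set_option autoImplicit false
-- the Theorems namespace of this sub repeats the summit name by design (D-0017 nested layout)
set_option linter.dupNamespace false

noncomputable section

open CategoryTheory NumberField Field Function
open _root_.TopRep _root_.ContRepresentation _root_.ContinuousCohomology
open Literature.NumberTheory.GaloisRepresentations
open Literature.NumberTheory.GaloisCohomology

universe u v

namespace Summit.BirchSwinnertonDyer.BirchSwinnertonDyer.Theorems.SignedEC.ShaThree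

/-! ## §1 Inner automorphisms act trivially on `H³` -/

section Inner

variable {R : Type u} [CommRing R] [TopologicalSpace R]
variable {G : Type v} [Group G] [TopologicalSpace G] [IsTopologicalGroup G] [LocallyCompactSpace G]
variable {H : Type v} [Group H] [TopologicalSpace H] [IsTopologicalGroup H] [LocallyCompactSpace H]
variable {X : TopRep.{v} R G} {Y : TopRep.{v} R H}

/-- **Inner automorphisms act trivially on `H³`** (Serre, *Corps locaux*, VII §5 Prop. 3), relative form as in the
tree's `map_eq_map_of_inner_two`: for `ι, θ : H → G` with `θ(x) = g⁻¹ ι(x) g` and coefficient maps with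
`f₁ = f₂ ∘ g`, the maps `H³(G, X) → H³(H, Y)` induced by `(θ, f₁)` and `(ι, f₂)` agree.  On `3`-cocycles
`g·z(σ^g, τ^g, υ^g) - z(σ, τ, υ) = (dh)(σ, τ, υ)` with `h(σ, τ) = z(g, σ^g, τ^g) - z(σ, g, τ^g) + z(σ, τ, g)`,
`σ^g = g⁻¹ σ g` (four instances of the cocycle identity). [cite: SerreLocalFields1979, VII §5 Prop. 3] -/
theorem map_eq_map_of_inner_three (g : G) (ι θ : H →ₜ* G) (hθ : ∀ x, θ x = g⁻¹ * ι x * g)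
    (f₁ : res (θ : H →* G) X ⟶ Y) (f₂ : res (ι : H →* G) X ⟶ Y)
    (hf : ∀ v, f₁.hom v = f₂.hom (X.ρ g v)) (x : continuousCohomology 3 X) :
    ContinuousCohomology.map θ f₁ 3 x = ContinuousCohomology.map ι f₂ 3 x := by
  obtain ⟨z, rfl⟩ := threeCocycleClass_surjective X x
  rw [map_threeCocycleClass, map_threeCocycleClass, ← sub_eq_zero, ← threeCocycleClass_sub,
    threeCocycleClass_eq_zero_iff_dTwo]
  let b : C(H × H, Y) := ⟨fun p => f₂.hom (z.1 (g, g⁻¹ * ι p.1 * g, g⁻¹ * ι p.2 * g) -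
      z.1 (ι p.1, g, g⁻¹ * ι p.2 * g) + z.1 (ι p.1, ι p.2, g)),
    f₂.hom.continuous.comp (((z.1.continuous.comp (continuous_const.prodMk
      (((continuous_const.mul (ι.continuous.comp continuous_fst)).mul continuous_const).prodMk
        ((continuous_const.mul (ι.continuous.comp continuous_snd)).mul continuous_const)))).sub
      (z.1.continuous.comp ((ι.continuous.comp continuous_fst).prodMk (continuous_const.prodMk
        ((continuous_const.mul (ι.continuous.comp continuous_snd)).mul continuous_const))))).add
      (z.1.continuous.comp ((ι.continuous.comp continuous_fst).prodMk
        ((ι.continuous.comp continuous_snd).prodMk continuous_const))))⟩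
  refine ⟨b, fun σ τ υ => ?_⟩
  rw [dTwo_apply]
  change f₁.hom (z.1 (θ σ, θ τ, θ υ)) - f₂.hom (z.1 (ι σ, ι τ, ι υ)) =
    Y.ρ σ (f₂.hom (z.1 (g, g⁻¹ * ι τ * g, g⁻¹ * ι υ * g) - z.1 (ι τ, g, g⁻¹ * ι υ * g) + z.1 (ι τ, ι υ, g))) -
      f₂.hom (z.1 (g, g⁻¹ * ι (σ * τ) * g, g⁻¹ * ι υ * g) - z.1 (ι (σ * τ), g, g⁻¹ * ι υ * g) +
        z.1 (ι (σ * τ), ι υ, g)) +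
      f₂.hom (z.1 (g, g⁻¹ * ι σ * g, g⁻¹ * ι (τ * υ) * g) - z.1 (ι σ, g, g⁻¹ * ι (τ * υ) * g) +
        z.1 (ι σ, ι (τ * υ), g)) -
      f₂.hom (z.1 (g, g⁻¹ * ι σ * g, g⁻¹ * ι τ * g) - z.1 (ι σ, g, g⁻¹ * ι τ * g) + z.1 (ι σ, ι τ, g))
  -- four instances of the `3`-cocycle identity
  have I1 := z.2 (ι σ) (ι τ) (ι υ) g
  have I2 := z.2 (ι σ) (ι τ) g (g⁻¹ * ι υ * g)
  have I3 := z.2 (ι σ) g (g⁻¹ * ι τ * g) (g⁻¹ * ι υ * g)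
  have I4 := z.2 g (g⁻¹ * ι σ * g) (g⁻¹ * ι τ * g) (g⁻¹ * ι υ * g)
  have e1 : ι τ * g = g * (g⁻¹ * ι τ * g) := by group
  have e2 : g * (g⁻¹ * ι υ * g) = ι υ * g := by group
  have e3 : g⁻¹ * ι τ * g * (g⁻¹ * ι υ * g) = g⁻¹ * ι (τ * υ) * g := by rw [map_mul]; group
  have e4 : ι σ * g = g * (g⁻¹ * ι σ * g) := by group
  have e5 : g⁻¹ * ι σ * g * (g⁻¹ * ι τ * g) = g⁻¹ * ι (σ * τ) * g := by rw [map_mul]; group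
  rw [← map_mul ι, ← map_mul ι] at I1
  rw [e1, e2, ← map_mul ι] at I2
  rw [e4, e3] at I3
  rw [e5, e3] at I4
  rw [hf, hθ, hθ, hθ, ← TopRep.hom_comm_apply f₂ σ, ← map_sub, ← map_sub, ← map_add, ← map_sub]
  refine congrArg f₂.hom ?_
  change X.ρ g (z.1 (g⁻¹ * ι σ * g, g⁻¹ * ι τ * g, g⁻¹ * ι υ * g)) - z.1 (ι σ, ι τ, ι υ) =
    X.ρ (ι σ) (z.1 (g, g⁻¹ * ι τ * g, g⁻¹ * ι υ * g) - z.1 (ι τ, g, g⁻¹ * ι υ * g) + z.1 (ι τ, ι υ, g)) -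
      (z.1 (g, g⁻¹ * ι (σ * τ) * g, g⁻¹ * ι υ * g) - z.1 (ι (σ * τ), g, g⁻¹ * ι υ * g) +
        z.1 (ι (σ * τ), ι υ, g)) +
      (z.1 (g, g⁻¹ * ι σ * g, g⁻¹ * ι (τ * υ) * g) - z.1 (ι σ, g, g⁻¹ * ι (τ * υ) * g) +
        z.1 (ι σ, ι (τ * υ), g)) -
      (z.1 (g, g⁻¹ * ι σ * g, g⁻¹ * ι τ * g) - z.1 (ι σ, g, g⁻¹ * ι τ * g) + z.1 (ι σ, ι τ, g))
  rw [map_add, map_sub, eq_sub_of_add_eq (eq_sub_of_add_eq I1), eq_sub_of_add_eq (eq_sub_of_add_eq I2),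
    eq_sub_of_add_eq (eq_sub_of_add_eq I3), eq_sub_of_add_eq (eq_sub_of_add_eq I4)]
  abel

end Inner

/-! ## §2 Pull-back along a homomorphism from a group of order `≤ 2` hitting an involution -/

section Involution

variable {K : Type} [Field K] [NumberField K]
variable {M : Type} [AddCommGroup M] [TopologicalSpace M] [DiscreteTopology M]

/-- **A class of `H³(K, M)` vanishing at every real place vanishes on every decomposition group of a real place,
however embedded.**  Let `ψ : Γ_L →ₜ* Γ_K` be a continuous homomorphism from the absolute Galois group of a field
`L` with `Γ_L = {1, σ}` and `ψ σ` an involution of `Γ_K`.  If `x ∈ H³(K, M)` has `loc_w x = 0` at every real place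
`w` of `K`, then the pull-back of `x` along `ψ` is `0`.  (`ψ σ` is a complex conjugation at some real `w₀`
(Artin–Schreier), conjugate to the image `c` of the generator of `Γ_{K_{w₀}}`: `ψ σ = g c g⁻¹`; by §1 the
pull-back along `ψ` is the pull-back along `Γ_L ≅ Γ_{K_{w₀}} → Γ_K` twisted by `g`, which factors through
`loc_{w₀} x = 0`.) [cite: ArtinSchreier1927Kennzeichnung, Satz 4] [cite: SerreLocalFields1979, VII §5 Prop. 3]
[cite: MilneADT2006, Ch. I, Thm. 4.10 (c)] -/
theorem pullback_three_eq_zero_of_forall_localization_inl (ρ : DiscreteGaloisModule K M)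
    (x : galoisCohomology ρ 3)
    (hx : ∀ w : InfinitePlace K, w.IsReal → galoisCohomology.localization ρ (Sum.inl w) 3 x = 0)
    {L : Type} [Field L] (ψ : absoluteGaloisGroup L →ₜ* absoluteGaloisGroup K)
    (σ : absoluteGaloisGroup L) (hL : ∀ h : absoluteGaloisGroup L, h = 1 ∨ h = σ)
    (hσ1 : ψ σ ≠ 1) (hσ2 : ψ σ * ψ σ = 1) :
    galoisCohomology.pullback ρ ψ 3 x = 0 := by
  classical
  haveI : CompactSpace (absoluteGaloisGroup K) := absoluteGaloisGroup_compactSpace K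
  haveI : CompactSpace (absoluteGaloisGroup L) := absoluteGaloisGroup_compactSpace L
  -- `ψ σ` is a complex conjugation at some real place `w₀`
  obtain ⟨w₀, hw₀, hd⟩ := exists_isComplexConjugationAt_of_sq_eq_one (ψ σ) hσ1 (by rw [pow_two, hσ2])
  haveI : CompactSpace (absoluteGaloisGroup (Place.Completion (Sum.inl w₀ : Place K))) :=
    absoluteGaloisGroup_compactSpace _
  -- `Γ_{K_{w₀}} = {1, τ₀}`, and `c := res τ₀` is a complex conjugation at `w₀`, conjugate to `ψ σ`
  obtain ⟨τ₀, hτ₀, hall₀⟩ := exists_ne_one_forall_eq_of_isReal (K := K) hw₀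
  set φ := absGaloisRestrict K (Place.Completion (Sum.inl w₀ : Place K)) with hφ
  have hc : IsComplexConjugationAt hw₀ (φ τ₀) := isComplexConjugationAt_absGaloisRestrict_of_ne_one hw₀ hτ₀
  obtain ⟨g, hg⟩ := isConj_iff.1 ((hc.isConj_iff_eq hd).2 rfl)
  -- hg : g * φ τ₀ * g⁻¹ = ψ σ
  have hσσ : σ * σ = 1 := by
    rcases hL (σ * σ) with h | h
    · exact h
    · -- `σ * σ = σ` forces `σ = 1`, contradicting `ψ σ ≠ 1`
      have : σ = 1 := mul_left_cancel (a := σ) (by rw [h, mul_one])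
      exact absurd (by rw [this, map_one]) hσ1
  have hττ : τ₀ * τ₀ = 1 := by
    rcases hall₀ (τ₀ * τ₀) with h | h
    · exact h
    · have : τ₀ = 1 := mul_left_cancel (a := τ₀) (by rw [h, mul_one])
      exact absurd this hτ₀
  have hσne : σ ≠ 1 := fun h => hσ1 (by rw [h, map_one])
  -- the isomorphism `α : Γ_L → Γ_{K_{w₀}}`, `σ ↦ τ₀`
  haveI : Finite (absoluteGaloisGroup (Place.Completion (Sum.inl w₀ : Place K))) :=
    finite_absoluteGaloisGroup_placeCompletion_inl K w₀
  have hLfin : Finite (absoluteGaloisGroup L) := by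
    refine Finite.of_surjective (fun b : Bool => if b then σ else 1) fun h => ?_
    rcases hL h with rfl | rfl
    · exact ⟨false, rfl⟩
    · exact ⟨true, rfl⟩
  haveI := hLfin
  let α₀ : absoluteGaloisGroup L →* absoluteGaloisGroup (Place.Completion (Sum.inl w₀ : Place K)) :=
    { toFun := fun h => if h = 1 then 1 else τ₀
      map_one' := if_pos rfl
      map_mul' := fun a b => by
        rcases hL a with rfl | rfl <;> rcases hL b with rfl | rfl
        · simp
        · simp [hσne]
        · simp [hσne]
        · rw [hσσ, if_pos rfl, if_neg hσne]
          exact hττ.symm }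
  have hα₀σ : α₀ σ = τ₀ := if_neg hσne
  let α : absoluteGaloisGroup L →ₜ* absoluteGaloisGroup (Place.Completion (Sum.inl w₀ : Place K)) :=
    ⟨α₀, continuous_of_discreteTopology⟩
  have hασ : α σ = τ₀ := hα₀σ
  -- `ψ h = g (φ (α h)) g⁻¹` for all `h`
  have hψ : ∀ h, ψ h = g⁻¹⁻¹ * (φ.comp α) h * g⁻¹ := fun h => by
    obtain h1 | h2 := hL h
    · rw [h1, map_one, map_one, mul_one, inv_inv, mul_inv_cancel]
    · rw [h2, inv_inv]
      change ψ σ = g * φ (α σ) * g⁻¹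
      rw [hασ, hg]
  -- §1: the pull-back along `ψ` is the `g`-twisted pull-back along `φ ∘ α`
  let Y : TopRep ℤ (absoluteGaloisGroup L) := DiscreteGaloisModule.toTopRep (ContinuousRep.restrict ρ ψ)
  let f₁ : TopRep.res (ψ : absoluteGaloisGroup L →* absoluteGaloisGroup K) ρ.toTopRep ⟶ Y :=
    TopRep.ofHom ⟨ContinuousLinearMap.id ℤ M, fun _ => rfl⟩
  have hrel : ∀ (h : absoluteGaloisGroup L) (v : M), ρ g (ρ (φ (α h)) v) = ρ (ψ h) (ρ g v) := fun h v => by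
    rw [hψ h, inv_inv, ← Module.End.mul_apply, ← _root_.map_mul, ← Module.End.mul_apply,
      ← _root_.map_mul, inv_mul_cancel_right]
    rfl
  let f₂ : TopRep.res ((φ.comp α : absoluteGaloisGroup L →ₜ* absoluteGaloisGroup K) :
      absoluteGaloisGroup L →* absoluteGaloisGroup K) ρ.toTopRep ⟶ Y :=
    TopRep.ofHom ⟨⟨(ρ g : M →ₗ[ℤ] M), continuous_of_discreteTopology⟩, fun h => by
      ext v
      exact hrel h v⟩
  have hmain : galoisCohomology.pullback ρ ψ 3 x = (ContinuousCohomology.map (φ.comp α) f₂ 3).hom x := by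
    change (ContinuousCohomology.map ψ f₁ 3).hom x = _
    exact map_eq_map_of_inner_three g⁻¹ (φ.comp α) ψ hψ f₁ f₂ (fun v => by
      change v = ρ g (ρ g⁻¹ v)
      rw [← Module.End.mul_apply, ← _root_.map_mul, mul_inv_cancel, _root_.map_one, Module.End.one_apply]) x
  -- factor through `loc_{w₀} x = 0`
  let Y₀ : TopRep ℤ (absoluteGaloisGroup (Place.Completion (Sum.inl w₀ : Place K))) :=
    DiscreteGaloisModule.toTopRep (ρ.toLocal (Sum.inl w₀))
  let f₀ : TopRep.res (φ : _ →* absoluteGaloisGroup K) ρ.toTopRep ⟶ Y₀ :=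
    TopRep.ofHom ⟨ContinuousLinearMap.id ℤ M, fun _ => rfl⟩
  let g₂ : TopRep.res (α : absoluteGaloisGroup L →* _) Y₀ ⟶ Y :=
    TopRep.ofHom ⟨⟨(ρ g : M →ₗ[ℤ] M), continuous_of_discreteTopology⟩, fun h => by
      ext v
      exact hrel h v⟩
  have hcomp : ContinuousCohomology.map (φ.comp α) f₂ 3 =
      ContinuousCohomology.map φ f₀ 3 ≫ ContinuousCohomology.map α g₂ 3 := by
    rw [← ContinuousCohomology.map_comp]
    exact ContinuousCohomology.map_congr_of_eq rfl _ _ (fun _ => rfl) 3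
  have hloc : (ContinuousCohomology.map φ f₀ 3).hom x = 0 := hx w₀ hw₀
  rw [hmain, hcomp]
  change (ContinuousCohomology.map α g₂ 3).hom ((ContinuousCohomology.map φ f₀ 3).hom x) = 0
  rw [hloc, map_zero]

end Involution

/-! ## §3 Restriction to a finite extension kills nothing new at the real places -/

section ResLoc

variable {K : Type} [Field K] [NumberField K]
variable {M : Type} [AddCommGroup M] [TopologicalSpace M] [DiscreteTopology M]

/-- **`loc_{w'} ∘ Res_{F/K}` vanishes on classes vanishing at the real places of `K`.**  For a finite extension of
number fields `F/K`, a discrete `Γ_K`-module `M`, and `x ∈ H³(K, M)` with `loc_w x = 0` at every real place `w` of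
`K`: `loc_{w'} (Res_{F/K} x) = 0` at every real place `w'` of `F` (the composite `Γ_{F_{w'}} → Γ_F → Γ_K` sends the
generator to an involution of `Γ_K`; §2). [cite: SerreGaloisCohomology1997, II §6.1] [cite: MilneADT2006, Ch. I, Thm. 4.10 (c)] -/
theorem localization_inl_res_three_eq_zero (ρ : DiscreteGaloisModule K M) (F : Type) [Field F] [NumberField F]
    [Algebra K F] [Algebra.IsAlgebraic K F] (x : galoisCohomology ρ 3)
    (hx : ∀ w : InfinitePlace K, w.IsReal → galoisCohomology.localization ρ (Sum.inl w) 3 x = 0)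
    (w' : InfinitePlace F) (hw' : w'.IsReal) :
    galoisCohomology.localization (ρ.restrictField F) (Sum.inl w') 3 (galoisCohomology.res ρ F 3 x) = 0 := by
  have hcomp := congrArg (fun T => T x) (galoisCohomology.res_comp ρ F (Place.Completion (Sum.inl w' : Place F)) 3)
  change galoisCohomology.localization (ρ.restrictField F) (Sum.inl w') 3 (galoisCohomology.res ρ F 3 x) =
    galoisCohomology.pullback ρ ((absGaloisRestrict K F).comp
      (absGaloisRestrict F (Place.Completion (Sum.inl w' : Place F)))) 3 x at hcomp
  rw [hcomp]
  obtain ⟨σ, hσ, hall⟩ := exists_ne_one_forall_eq_of_isReal (K := F) hw'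
  refine pullback_three_eq_zero_of_forall_localization_inl ρ x hx _ σ hall ?_ ?_
  · change absGaloisRestrict K F (absGaloisRestrict F w'.Completion σ) ≠ 1
    exact fun h => absGaloisRestrict_ne_one_of_isReal hw' hσ
      (absGaloisRestrict_injective K F (by rw [h, map_one]))
  · change absGaloisRestrict K F (absGaloisRestrict F w'.Completion σ) *
        absGaloisRestrict K F (absGaloisRestrict F w'.Completion σ) = 1
    rw [← map_mul, absGaloisRestrict_mul_self_of_isReal hw' hσ, map_one]

end ResLoc

/-! ## §4 `Res_{F/K}` is injective on `p`-primary classes when `p ∤ [F : K]` -/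

section ResInjective

variable {K : Type} [Field K] [NumberField K]
variable {M : Type} [AddCommGroup M] [TopologicalSpace M] [DiscreteTopology M]

/-- **Serre I §2.4 Prop. 9 in field form**: for a finite extension `F/K`, a class `x ∈ Hⁿ(K, M)` with
`Res_{F/K} x = 0` and `p ^ r • x = 0` vanishes as soon as `p ∤ [F : K]` (`Cor ∘ Res = [F : K]`, Bezout).
[cite: SerreGaloisCohomology1997, I §2.4 Prop. 9 and I §3.3 Prop. 14] -/
theorem eq_zero_of_res_eq_zero_of_psmul_eq_zero (ρ : DiscreteGaloisModule K M) (F : Type) [Field F]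
    [Algebra K F] [FiniteDimensional K F] {p r : ℕ} (hcop : (Module.finrank K F).Coprime p) (n : ℕ)
    (x : galoisCohomology ρ n) (hres : galoisCohomology.res ρ F n x = 0) (hp : (p ^ r) • x = 0) : x = 0 := by
  haveI : CompactSpace (absoluteGaloisGroup K) := absoluteGaloisGroup_compactSpace K
  have h1 : resSubgroup ρ.toTopRep (absGaloisRestrict K F).range n x = 0 := by
    rw [← galoisCohomology.rangeTransport_res ρ F n x, hres, map_zero]
  have h2 : (ρ : ContinuousRep (absoluteGaloisGroup K) ℤ M).Hpullback
      (subgroupIncl (absGaloisRestrict K F).range) n x = 0 := h1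
  have hopen : IsOpen ((absGaloisRestrict K F).range : Set (absoluteGaloisGroup K)) :=
    (isOpenEmbedding_absGaloisRestrict K F).isOpen_range
  have hm := index_smul_eq_zero_of_Hpullback_eq_zero_int (ρ : ContinuousRep (absoluteGaloisGroup K) ℤ M)
    hopen n x h2
  rw [index_range_absGaloisRestrict K F] at hm
  have h := gcd_nsmul_eq_zero.2 ⟨hm, hp⟩
  rwa [(Nat.Coprime.pow_right r hcop).gcd_eq_one, one_nsmul] at h

end ResInjective

/-! ## §5 The odd-degree descent for Milne I Thm. 4.10 (c)₃ -/

section Descent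

variable {K : Type} [Field K] [NumberField K]
variable {M : Type} [AddCommGroup M] [TopologicalSpace M] [DiscreteTopology M]

/-- **Odd-degree descent.**  Let `F/K` be a finite extension of number fields of ODD degree and `M` a discrete
`Γ_K`-module killed by `2 ^ r`.  If every class of `H³(F, M)` vanishing at all real places of `F` is `0`, then every
class of `H³(K, M)` vanishing at all real places of `K` is `0`.
[cite: MilneADT2006, Ch. I, Thm. 4.10 (c)] [cite: SerreGaloisCohomology1997, I §2.4 Prop. 9] -/
theorem realThree_injective_of_odd_extension (ρ : DiscreteGaloisModule K M) (F : Type) [Field F]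
    [NumberField F] [Algebra K F] [FiniteDimensional K F] (hodd : Odd (Module.finrank K F))
    {r : ℕ} (hM : ∀ m : M, (2 ^ r) • m = 0)
    (hF : ∀ y : galoisCohomology (ρ.restrictField F) 3,
      (∀ w' : InfinitePlace F, w'.IsReal →
        galoisCohomology.localization (ρ.restrictField F) (Sum.inl w') 3 y = 0) → y = 0) :
    ∀ x : galoisCohomology ρ 3,
      (∀ w : InfinitePlace K, w.IsReal → galoisCohomology.localization ρ (Sum.inl w) 3 x = 0) → x = 0 := by
  intro x hx
  haveI : CompactSpace (absoluteGaloisGroup K) := absoluteGaloisGroup_compactSpace K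
  haveI : Algebra.IsAlgebraic K F := Algebra.IsAlgebraic.of_finite K F
  have hres : galoisCohomology.res ρ F 3 x = 0 :=
    hF _ fun w' hw' => localization_inl_res_three_eq_zero ρ F x hx w' hw'
  have hcop : (Module.finrank K F).Coprime 2 := Nat.coprime_two_right.2 hodd
  -- `2 ^ r` kills the class `x` (it kills every `3`-cocycle)
  have hp : (2 ^ r) • x = 0 := by
    obtain ⟨z, rfl⟩ := threeCocycleClass_surjective _ x
    have hz : (2 ^ r) • z = 0 :=
      Subtype.ext (ContinuousMap.ext fun q => hM (z.1 q))
    have hcl := map_nsmul (threeCocycleClassₗ ρ.toTopRep) (2 ^ r) z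
    rw [hz, map_zero] at hcl
    exact hcl.symm
  exact eq_zero_of_res_eq_zero_of_psmul_eq_zero ρ F hcop 3 x hres hp

end Descent

end Summit.BirchSwinnertonDyer.BirchSwinnertonDyer.Theorems.SignedEC.ShaThree

end
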